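import Mathlib.Algebra.Module.Basic
import Mathlib.Data.Nat.Prime.Basic
import Mathlib.RingTheory.Coprime.Lemmas
import Mathlib.RingTheory.Multiplicity
import Mathlib.Tactic.Abel
import Mathlib.Tactic.Ring
import HarnessLib

/-!
# Torsion-free `p`-adic limit families

Let `H` be an abelian group without `p`-torsion (`p • x = 0 → x = 0`, `p` a prime) and let
`e : ℕ → ℕ` be a monotone exponent function taking arbitrarily large values. The inverse limit
`lim_N H / p^{e N} H` — the `p`-adic completion of `H` — has no torsion whatsoever: a compatible
family `(ξ_N)_N`, `ξ_N ∈ H / p^{e N} H`, killed by a nonzero integer `L` is zero. This file proves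
that statement in REPRESENTATIVE form, i.e. for a sequence `x : ℕ → H` of lifts, writing
"`z ∈ p^k H`" as `∃ y, z = (p : ℤ) ^ k • y`:

* `family_mem_pow_smul_of_zsmul_mem` — **main theorem**: if `x (N+1) - x N ∈ p^{e N} H`
  (compatibility) and `L • x N ∈ p^{e N} H` for all `N` (the family is `L`-torsion), `L ≠ 0`, then
  `x N ∈ p^{e N} H` for all `N` (the family is zero).
  Proof: write `L = p^a L'` with `p ∤ L'`; `L'` is a unit modulo every `p^k` (Bézout), so
  `p^a x N ∈ p^{e N} H`; choose `M ≥ N` with `e M ≥ e N + a`, cancel `p^a` (no `p`-torsion) to get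
  `x M ∈ p^{e N} H`, and `x M ≡ x N (mod p^{e N} H)` by compatibility and monotonicity of `e`.
* `family_eq_zero` — the same through additive maps `q N : H →+ Q N` with kernel `p^{e N} H`
  (any models of the quotients `H / p^{e N} H`): a family `q N (x N)` compatible under the
  transition maps and killed by `L ≠ 0` vanishes identically.
* the helper steps, reusable on their own: `eq_zero_of_pow_zsmul_eq_zero`, `zsmul_pow_cancel`,
  `mem_pow_smul_of_pow_zsmul_mem` (cancelling `p^a`), `exists_eq_pow_mul_not_dvd`
  (`L = p^a L'`, `p ∤ L'`), `mem_pow_smul_of_not_dvd_of_zsmul_mem` (`L'` coprime to `p` acts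
  invertibly modulo `p^k`), `sub_mem_pow_smul_of_le` (compatibility chains).

## Why

This is the abstract algebra of the vanishing step for X. Hu's infinitesimal obstruction classes
(arXiv:2507.12458, Prop. 11.1 [Hu2025TruncatedWitt]): for a smooth proper `𝒳` over `W(k)` the
obstructions `ob_{1,N}[E₁] ∈ ℍ^{2r}(X_1, p(r)Ω•_{X_N}) ≅ H^b(𝒳, Ωʲ) / p^{e(N)}` to lifting the class of
a vector bundle `E₁` on the special fibre form a compatible family, and they are killed by the
common denominator `L` of a rational pro-lift of the class. When the Hodge cohomology
`H = H^b(𝒳, Ωʲ)` is `p`-torsion-free and `e(N) → ∞`, the theorems below force every `ob_{1,N}[E₁]`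
to vanish.

## What is not here

No inverse-limit object, completion or quotient group is constructed: all statements are about
representatives in `H` (and, in `family_eq_zero`, about arbitrary additive maps with the right
kernels). Nothing scheme-theoretic is mentioned. Everything is elementary and fully proved;
Mathlib supplies `FiniteMultiplicity` (to split off the `p`-part of `L`) and `IsCoprime` (Bézout).
-/

namespace Literature.Algebra.Homology

variable {H : Type*} [AddCommGroup H] {p : ℕ}

/-! ### Cancelling powers of `p` in a group without `p`-torsion -/

/-- If the abelian group `H` has no `p`-torsion, it has no `p^a`-torsion: `p^a • x = 0` forces
`x = 0`. [folklore] -/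
theorem eq_zero_of_pow_zsmul_eq_zero (htf : ∀ x : H, (p : ℤ) • x = 0 → x = 0) (a : ℕ) (x : H)
    (hx : ((p : ℤ) ^ a) • x = 0) : x = 0 := by
  induction a generalizing x with
  | zero => simpa using hx
  | succ a ih =>
    rw [pow_succ, mul_smul] at hx
    exact htf x (ih _ hx)

/-- Cancellation of `p^a` in an abelian group without `p`-torsion: if `p^a • x = p^(a + c) • y`
then `x = p^c • y`. [folklore] -/
theorem zsmul_pow_cancel (htf : ∀ x : H, (p : ℤ) • x = 0 → x = 0) {a c : ℕ} {x y : H}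
    (h : ((p : ℤ) ^ a) • x = ((p : ℤ) ^ (a + c)) • y) : x = ((p : ℤ) ^ c) • y := by
  have h0 : ((p : ℤ) ^ a) • (x - ((p : ℤ) ^ c) • y) = 0 := by
    rw [smul_sub, h, pow_add, mul_smul, sub_self]
  exact sub_eq_zero.mp (eq_zero_of_pow_zsmul_eq_zero htf a _ h0)

/-- In an abelian group without `p`-torsion, `p^a • x ∈ p^(a + c) H` implies `x ∈ p^c H`
(membership in `p^k H` written as `∃ y, · = p^k • y`). [folklore] -/
theorem mem_pow_smul_of_pow_zsmul_mem (htf : ∀ x : H, (p : ℤ) • x = 0 → x = 0) {a c : ℕ} {x : H}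
    (h : ∃ y : H, ((p : ℤ) ^ a) • x = ((p : ℤ) ^ (a + c)) • y) :
    ∃ y : H, x = ((p : ℤ) ^ c) • y := by
  obtain ⟨y, hy⟩ := h
  exact ⟨y, zsmul_pow_cancel htf hy⟩

/-! ### Splitting off the `p`-part of a nonzero integer; units modulo `p^k` -/

/-- Every nonzero integer `L` factors as `L = p^a * L'` with `p ∤ L'` (`p` a prime; only `p ≠ 1`
is used). [folklore] -/
theorem exists_eq_pow_mul_not_dvd (hp : p.Prime) {L : ℤ} (hL : L ≠ 0) :
    ∃ (a : ℕ) (L' : ℤ), L = (p : ℤ) ^ a * L' ∧ ¬ (p : ℤ) ∣ L' := by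
  have hfin : FiniteMultiplicity (p : ℤ) L :=
    Int.finiteMultiplicity_iff.mpr ⟨by simpa using hp.ne_one, hL⟩
  obtain ⟨L', hL', hndvd⟩ := hfin.exists_eq_pow_mul_and_not_dvd
  exact ⟨_, L', hL', hndvd⟩

/-- An integer `L'` prime to `p` acts invertibly modulo `p^k H`: if `L' • x ∈ p^k H` then
`x ∈ p^k H`. Proof: Bézout, `u L' + v p^k = 1`, so `x = u (L' x) + p^k (v x)`. [folklore] -/
theorem mem_pow_smul_of_not_dvd_of_zsmul_mem (hp : p.Prime) {L' : ℤ} (hL' : ¬ (p : ℤ) ∣ L')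
    {k : ℕ} {x : H} (h : ∃ y : H, L' • x = ((p : ℤ) ^ k) • y) :
    ∃ y : H, x = ((p : ℤ) ^ k) • y := by
  obtain ⟨y, hy⟩ := h
  have hcop : IsCoprime L' ((p : ℤ) ^ k) := by
    apply IsCoprime.pow_right
    rw [Int.isCoprime_iff_gcd_eq_one]
    have h1 : ¬ p ∣ L'.natAbs := fun hd => hL' (Int.natCast_dvd.mpr hd)
    have h2 : Nat.Coprime L'.natAbs p := ((Nat.Prime.coprime_iff_not_dvd hp).mpr h1).symm
    simpa [Int.gcd] using h2
  obtain ⟨u, v, huv⟩ := hcop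
  refine ⟨u • y + v • x, ?_⟩
  calc x = (u * L' + v * (p : ℤ) ^ k) • x := by rw [huv, one_smul]
    _ = u • (L' • x) + ((p : ℤ) ^ k * v) • x := by rw [add_smul, mul_smul, mul_comm v]
    _ = ((p : ℤ) ^ k) • (u • y + v • x) := by
      rw [hy, smul_smul, mul_comm u, mul_smul, mul_smul, ← smul_add]

/-! ### Compatible families -/

/-- Compatibility propagates along the tower: if `x (N+1) - x N ∈ p^{e N} H` for every `N` and `e`
is monotone, then `x N' - x N ∈ p^{e N} H` for all `N ≤ N'`. [folklore] -/
theorem sub_mem_pow_smul_of_le {e : ℕ → ℕ} (he : Monotone e) (x : ℕ → H)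
    (hx : ∀ N, ∃ y : H, x (N + 1) - x N = ((p : ℤ) ^ e N) • y) {N N' : ℕ} (hNN' : N ≤ N') :
    ∃ y : H, x N' - x N = ((p : ℤ) ^ e N) • y := by
  induction N', hNN' using Nat.le_induction with
  | base => exact ⟨0, by simp⟩
  | succ M hNM ih =>
    obtain ⟨y₁, hy₁⟩ := ih
    obtain ⟨y₂, hy₂⟩ := hx M
    obtain ⟨c, hc⟩ : ∃ c, e M = e N + c := ⟨e M - e N, by have := he hNM; omega⟩
    refine ⟨((p : ℤ) ^ c) • y₂ + y₁, ?_⟩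
    calc x (M + 1) - x N = (x (M + 1) - x M) + (x M - x N) := by abel
      _ = ((p : ℤ) ^ e N) • (((p : ℤ) ^ c) • y₂ + y₁) := by
        rw [hy₁, hy₂, hc, pow_add, mul_smul, smul_add]

/-- **Torsion-freeness of `p`-adic limits of a `p`-torsion-free group (representative form).**
Let `H` be an abelian group without `p`-torsion, `p` prime, `e : ℕ → ℕ` monotone and unbounded,
and `x : ℕ → H` a sequence with `x (N+1) ≡ x N (mod p^{e N} H)` for all `N` (a compatible family in
the tower `⋯ → H/p^{e (N+1)} H → H/p^{e N} H → ⋯`). If a nonzero integer `L` kills the family,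
`L • x N ∈ p^{e N} H` for all `N`, then the family is zero: `x N ∈ p^{e N} H` for all `N`.
Equivalently, `lim_N H/p^{e N} H` is torsion-free. [folklore] -/
theorem family_mem_pow_smul_of_zsmul_mem (hp : p.Prime)
    (htf : ∀ x : H, (p : ℤ) • x = 0 → x = 0) {e : ℕ → ℕ} (he : Monotone e)
    (he' : ∀ m : ℕ, ∃ N, m ≤ e N) (x : ℕ → H)
    (hx : ∀ N, ∃ y : H, x (N + 1) - x N = ((p : ℤ) ^ e N) • y) {L : ℤ} (hL : L ≠ 0)
    (hLx : ∀ N, ∃ y : H, L • x N = ((p : ℤ) ^ e N) • y) :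
    ∀ N, ∃ y : H, x N = ((p : ℤ) ^ e N) • y := by
  intro N
  -- split off the `p`-part of `L`
  obtain ⟨a, L', hLeq, hndvd⟩ := exists_eq_pow_mul_not_dvd hp hL
  -- `p^a • x M ∈ p^{e M} H` for every `M`, since `L'` is a unit modulo `p^{e M}`
  have hpa : ∀ M, ∃ y : H, ((p : ℤ) ^ a) • x M = ((p : ℤ) ^ e M) • y := fun M =>
    mem_pow_smul_of_not_dvd_of_zsmul_mem hp hndvd (by
      obtain ⟨y, hy⟩ := hLx M
      exact ⟨y, by rw [smul_smul, mul_comm, ← hLeq, hy]⟩)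
  -- choose a level `M ≥ N` with `e M ≥ a + e N`
  obtain ⟨N', hN'⟩ := he' (a + e N)
  have hNM : N ≤ max N N' := le_max_left _ _
  obtain ⟨c, hc⟩ : ∃ c, e (max N N') = a + e N + c :=
    ⟨e (max N N') - (a + e N), by have := hN'.trans (he (le_max_right N N')); omega⟩
  -- cancel `p^a`: `x M ∈ p^{e N} H`
  obtain ⟨y, hy⟩ := hpa (max N N')
  obtain ⟨z, hz⟩ : ∃ z : H, x (max N N') = ((p : ℤ) ^ e N) • z :=
    mem_pow_smul_of_pow_zsmul_mem htf (a := a) ⟨((p : ℤ) ^ c) • y, by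
      rw [hy, hc, smul_smul, ← pow_add]⟩
  -- and `x M ≡ x N (mod p^{e N} H)`
  obtain ⟨w, hw⟩ := sub_mem_pow_smul_of_le he x hx hNM
  exact ⟨z - w, by rw [smul_sub, ← hz, ← hw, sub_sub_cancel]⟩

/-- **A compatible `L`-torsion family in `(H / p^{e N} H)_N` vanishes** (`H` without `p`-torsion,
`e` monotone and unbounded, `L ≠ 0`), phrased through arbitrary additive maps `q N : H →+ Q N` with
kernel exactly `p^{e N} H` (e.g. the quotient maps): if `x : ℕ → H` lifts a family with
`q N (x (N+1)) = q N (x N)` (compatibility) and `L • q N (x N) = 0` for all `N`, then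
`q N (x N) = 0` for all `N`. [folklore] -/
theorem family_eq_zero (hp : p.Prime)
    (htf : ∀ x : H, (p : ℤ) • x = 0 → x = 0) {e : ℕ → ℕ} (he : Monotone e)
    (he' : ∀ m : ℕ, ∃ N, m ≤ e N) {Q : ℕ → Type*} [∀ N, AddCommGroup (Q N)]
    (q : ∀ N, H →+ Q N) (hq : ∀ (N : ℕ) (z : H), q N z = 0 ↔ ∃ y : H, z = ((p : ℤ) ^ e N) • y)
    (x : ℕ → H) (hx : ∀ N, q N (x (N + 1)) = q N (x N)) {L : ℤ} (hL : L ≠ 0)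
    (hLx : ∀ N, L • q N (x N) = 0) (N : ℕ) : q N (x N) = 0 :=
  (hq N (x N)).mpr
    (family_mem_pow_smul_of_zsmul_mem hp htf he he' x
      (fun M => (hq M _).mp (by rw [map_sub, sub_eq_zero]; exact hx M)) hL
      (fun M => (hq M _).mp (by rw [map_zsmul]; exact hLx M)) N)

end Literature.Algebra.Homology
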